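/-
Copyright: the b2b-balaban T⁴-continuum CRUX team, row NE7b OWNER lineage `t4-ne7b-p1` (gen 141). Project licence.
-/
import Summits.QuantumFields.BalabanUV.T4Continuum.Spine.NE7b.SupWhitenedObservableMoments

/-!
# THE SIXTH CENTRED MOMENT OF A GENERIC LIPSCHITZ OBSERVABLE UNDER `N(0,AAᵀ)` IN WHITENED COORDINATES — the moment letter `M₆` of the
# fourth-cumulant tree bound ((496)–(499) carried it as a hypothesis) for ANY `ξ`-`C¹` observable `g` with `‖D_ξg‖ ≤ L` (SCOPING (d13)(2)).
# One more Poincaré step ((422), `M = I`, floor `1`, secant letter `λγ_op`) on `(g − μ)³` (`‖D(g−μ)³‖² ≤ 9L²(g−μ)⁴`) gives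
# `Var_ν̃((g−μ)³) ≤ 9L²E(g−μ)⁴∕(1−λγ_op)`, and the discriminant form of Cauchy–Schwarz (`E(s(g−μ) + (g−μ)²)² ≥ 0` for all `s`, Mathlib's
# `discrim_le_zero`) gives `(E(g−μ)³)² ≤ E(g−μ)²·E(g−μ)⁴`; with (503)'s `E(g−μ)² ≤ L²∕(1−λγ_op)` and `E(g−μ)⁴ ≤ 5L⁴∕(1−λγ_op)²`:
#   `E_ν̃(g − μ)⁶ ≤ (E(g−μ)² + 9L²∕(1−λγ_op))·E(g−μ)⁴ ≤ 50L⁶∕(1 − λγ_op)³`   (uniform in `ψ` and the volume)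
# given the integrability letters `e·g, e·g², e·g⁴, e·g⁶ ∈ L¹(N(0,I))` (row NE7b, node U5c; (422) `tilted_poincare`, (503), (464), (458), (456)
# BY NAME; [folklore] + [cite: BrascampLieb1976, Thm 4.1] through (422))

Cell `pub-balaban`, sub-cell `t4`, spine estimate NE7b (`T4WeightBudget.RelWeightBound`; the cell's OWN estimate — NOT PRINTED in
[Bałaban 1983–89], NOT PROVED).  Crux-route work under `Spine/NE7b/` by the row OWNER (`t4-ne7b-p1` gen 141, file (504)) under FREEZE
(0)'s crux-prover clause; NOTHING of Bałaban's is named as a Lean object, valued or asserted; no `T4Continuum/Support` leaf typed; no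
`def`, no notation; zero `sorry`.  Imports (BY NAME): the OWNER's (503) `…SupWhitenedObservableMoments` (`obs_variance_le`,
`obs_fourth_moment_le`; through it (464) `whitened_secant`, `one_floor`, (422) `tilted_poincare`, (458) `whitened_exp_integrable`,
`op_letter_nonneg`, (456) `whitened_hasFDerivAt`).

WHAT IS PROVED ([folklore]; generic `g` with `‖D_ξg‖ ≤ L`):
* §1 **`obs_centred_variance_le`** (`Z⁻¹∫e(g − μ)² ≤ L²∕(1−λγ_op)`, the variance identity inline).
* §2 `sixth_pow_sub_le` (`(x−y)⁶ ≤ 32(x⁶+y⁶)`), THE END **`obs_sixth_moment_le`** (`Z⁻¹∫e(g − μ)⁶ ≤ 50L⁶∕(1−λγ_op)³`); §3 toy.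

HONEST (what this is NOT).  A moment letter for a generic observable; its Gibbs-format transfer and the instantiation for the gradient
components (`L = κ₂√γ_op`, with (423) extended to `e‖U′‖⁶ ∈ L¹`) that discharges `M₆` in (497)–(499) are the next file; the
three-point pieces and the cumulant FORM of `∂⁴W` are NOT typed.  Scalar skeleton ((A3), NC-NE7b-α UNRULED); nothing of Bałaban's
asserted.  BY-NAME EFFECT ON THE WALL: NONE.  NE7b NOT PRINTED ∕ NOT PROVED; spine PROVED 0∕9; rung (B)+1 — the programme's measures remain
FINITE-torus statements; NOT the mass gap, NOT Clay.  HONEST DEPENDENCY: continuum YM on T⁴ ⇐ BetaPertH ∧ nine spine estimates (0∕9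
proved); BetaPertH ⇐ (D1) ∧ (D4) ∧ CAP+tail; G-an2-4 gates asym, D1 and NE2∕3∕4.
-/

set_option autoImplicit false
set_option maxSynthPendingDepth 2

noncomputable section

namespace Summit.QuantumFields.BalabanUV.T4Continuum.NE7b.SupWhitenedObservableSixthMoment

open MeasureTheory ProbabilityTheory Real Set Function Finset Matrix
open scoped BigOperators
open Literature.Probability.Distributions (matrixCLM)
open SupWhitenedObservableMoments (obs_variance_le obs_fourth_moment_le)
open SupWhitenedPoincareLetters (whitened_secant one_floor)
open SupWhitenedMomentLetters (op_letter_nonneg whitened_exp_integrable)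
open SupWhitenedFirstOrderLetters (whitened_hasFDerivAt)
open SupTiltedPoincare (tilted_poincare)

variable {ι κ : Type} [Fintype ι] [DecidableEq ι] [Fintype κ] [DecidableEq κ]

variable {U : EuclideanSpace ℝ ι → ℝ} {U' : EuclideanSpace ℝ ι → EuclideanSpace ℝ ι →L[ℝ] ℝ} {A : Matrix ι κ ℝ} {γop κ₀ τ θ lam L : ℝ}
  {g : EuclideanSpace ℝ κ → ℝ} {g' : EuclideanSpace ℝ κ → EuclideanSpace ℝ κ →L[ℝ] ℝ}

/-! ## §1. The centred variance -/

/-- **`Z⁻¹∫e(g − μ)² ≤ L²∕(1 − λγ_op)`**, `μ = Z⁻¹∫e g`: (503)'s variance bound in centred form (`Z⁻¹∫e(g−μ)² = Z⁻¹∫e g² − μ²`).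
[folklore] -/
theorem obs_centred_variance_le [Nonempty ι] (hΓop : (γop • (1 : Matrix ι ι ℝ) - A * Aᵀ).PosSemidef) (Y : Finset ι)
    (hUd : ∀ φ : EuclideanSpace ℝ ι, HasFDerivAt U (U' φ) φ) (hκ₀ : 0 ≤ κ₀) (hτ : 0 < τ) (hθ1 : θ < 1) (hκθ : 2 * κ₀ * (1 + τ) * γop ≤ θ)
    (hstab : ∀ φ : EuclideanSpace ℝ ι, -(κ₀ * ∑ x ∈ Y, φ x ^ 2) ≤ U φ) (hlam : 0 ≤ lam)
    (hUsec : ∀ s : ℝ, 0 ≤ s → s ≤ 1 → ∀ a b : EuclideanSpace ℝ ι,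
      U ((1 - s) • a + s • b) - lam / 2 * (s * (1 - s)) * ∑ i, (a i - b i) ^ 2 ≤ (1 - s) * U a + s * U b)
    (hρ : lam * γop < 1) (ψ : EuclideanSpace ℝ ι) (hgd : ∀ ξ : EuclideanSpace ℝ κ, HasFDerivAt g (g' ξ) ξ) (hg'c : Continuous g')
    (hg'b : ∀ ξ : EuclideanSpace ℝ κ, ‖g' ξ‖ ≤ L)
    (k1 : Integrable (fun ξ : EuclideanSpace ℝ κ => exp (-U (matrixCLM A ξ + ψ)) * g ξ) (multivariateGaussian 0 (1 : Matrix κ κ ℝ)))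
    (k2 : Integrable (fun ξ : EuclideanSpace ℝ κ => exp (-U (matrixCLM A ξ + ψ)) * g ξ ^ 2) (multivariateGaussian 0 (1 : Matrix κ κ ℝ))) :
    (∫ ξ : EuclideanSpace ℝ κ, exp (-U (matrixCLM A ξ + ψ)) ∂(multivariateGaussian 0 (1 : Matrix κ κ ℝ)))⁻¹ *
        (∫ ξ : EuclideanSpace ℝ κ, exp (-U (matrixCLM A ξ + ψ)) * (g ξ - ((∫ ξ : EuclideanSpace ℝ κ, exp (-U (matrixCLM A ξ + ψ))
            ∂(multivariateGaussian 0 (1 : Matrix κ κ ℝ)))⁻¹ * (∫ ξ : EuclideanSpace ℝ κ, exp (-U (matrixCLM A ξ + ψ)) * g ξ ∂(multivariateGaussian 0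
            (1 : Matrix κ κ ℝ))))) ^ 2 ∂(multivariateGaussian 0 (1 : Matrix κ κ ℝ))) ≤
      L ^ 2 / (1 - lam * γop) := by
  have hUc : Continuous U := continuous_iff_continuousAt.2 fun φ => (hUd φ).continuousAt
  have hI := whitened_exp_integrable hΓop Y hUc.measurable hκ₀ hτ hθ1 hκθ hstab ψ
  have hZ : 0 < (∫ ξ : EuclideanSpace ℝ κ, exp (-U (matrixCLM A ξ + ψ)) ∂(multivariateGaussian 0 (1 : Matrix κ κ ℝ))) := integral_exp_pos hI
  set μ : ℝ := ((∫ ξ : EuclideanSpace ℝ κ, exp (-U (matrixCLM A ξ + ψ)) ∂(multivariateGaussian 0 (1 : Matrix κ κ ℝ)))⁻¹ * (∫ ξ : EuclideanSpace ℝ κ,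
      exp (-U (matrixCLM A ξ + ψ)) * g ξ ∂(multivariateGaussian 0 (1 : Matrix κ κ ℝ)))) with hμ
  have hVar := obs_variance_le hΓop Y hUd hκ₀ hτ hθ1 hκθ hstab hlam hUsec hρ ψ hgd hg'c hg'b k1 k2
  have e2 : ∀ ξ : EuclideanSpace ℝ κ, exp (-U (matrixCLM A ξ + ψ)) * (g ξ - μ) ^ 2 =
      exp (-U (matrixCLM A ξ + ψ)) * g ξ ^ 2 - 2 * μ * (exp (-U (matrixCLM A ξ + ψ)) * g ξ) + μ ^ 2 * exp (-U (matrixCLM A ξ + ψ)) := fun ξ => by ring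
  have hEq : (∫ ξ : EuclideanSpace ℝ κ, exp (-U (matrixCLM A ξ + ψ)) ∂(multivariateGaussian 0 (1 : Matrix κ κ ℝ)))⁻¹ * (∫ ξ : EuclideanSpace ℝ κ, exp
      (-U (matrixCLM A ξ + ψ)) * (g ξ - μ) ^ 2 ∂(multivariateGaussian 0 (1 : Matrix κ κ ℝ))) =
      (∫ ξ : EuclideanSpace ℝ κ, exp (-U (matrixCLM A ξ + ψ)) ∂(multivariateGaussian 0 (1 : Matrix κ κ ℝ)))⁻¹ * (∫ ξ : EuclideanSpace ℝ κ, exp (-U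
          (matrixCLM A ξ + ψ)) * g ξ ^ 2 ∂(multivariateGaussian 0 (1 : Matrix κ κ ℝ))) - μ ^ 2 := by
    simp_rw [e2]
    have iB : Integrable (fun ξ : EuclideanSpace ℝ κ => exp (-U (matrixCLM A ξ + ψ)) * g ξ ^ 2 - 2 * μ * (exp (-U (matrixCLM A ξ + ψ)) * g ξ))
        (multivariateGaussian 0 (1 : Matrix κ κ ℝ)) := k2.sub (k1.const_mul _)
    have iC : Integrable (fun ξ : EuclideanSpace ℝ κ => μ ^ 2 * exp (-U (matrixCLM A ξ + ψ))) (multivariateGaussian 0 (1 : Matrix κ κ ℝ)) :=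
        hI.const_mul _
    rw [integral_add iB iC, integral_sub k2 (k1.const_mul _), integral_const_mul, integral_const_mul]
    have hZne := hZ.ne'
    rw [hμ]
    field_simp
    ring
  rw [hEq]
  exact hVar

/-! ## §2. The sixth centred moment -/

/-- `(x − y)⁶ ≤ 32(x⁶ + y⁶)` (from `(x−y)² ≤ 2(x²+y²)` and `(a+b)³ ≤ 4(a³+b³)` for `a, b ≥ 0`). [folklore] -/
theorem sixth_pow_sub_le (x y : ℝ) : (x - y) ^ 6 ≤ 32 * (x ^ 6 + y ^ 6) := by
  have h1 : (x - y) ^ 2 ≤ 2 * (x ^ 2 + y ^ 2) := by nlinarith [sq_nonneg (x + y)]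
  have ha : 0 ≤ x ^ 2 := sq_nonneg x
  have hb : 0 ≤ y ^ 2 := sq_nonneg y
  have h2 : ((x - y) ^ 2) ^ 3 ≤ (2 * (x ^ 2 + y ^ 2)) ^ 3 := pow_le_pow_left₀ (sq_nonneg _) h1 3
  have h3 : (x ^ 2 + y ^ 2) ^ 3 ≤ 4 * ((x ^ 2) ^ 3 + (y ^ 2) ^ 3) := by
    nlinarith [mul_nonneg (sq_nonneg (x ^ 2 - y ^ 2)) (add_nonneg ha hb)]
  calc (x - y) ^ 6 = ((x - y) ^ 2) ^ 3 := by ring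
    _ ≤ (2 * (x ^ 2 + y ^ 2)) ^ 3 := h2
    _ = 8 * (x ^ 2 + y ^ 2) ^ 3 := by ring
    _ ≤ 8 * (4 * ((x ^ 2) ^ 3 + (y ^ 2) ^ 3)) := by linarith [h3]
    _ = 32 * (x ^ 6 + y ^ 6) := by ring

/-- **`E_ν̃(g − μ)⁶ ≤ 50L⁶∕(1 − λγ_op)³`**: Poincaré on `(g − μ)³`, the discriminant Cauchy–Schwarz `(E(g−μ)³)² ≤ E(g−μ)²E(g−μ)⁴`, and
(503); `e·g, e·g², e·g⁴, e·g⁶ ∈ L¹(N(0,I))`. [folklore] -/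
theorem obs_sixth_moment_le [Nonempty ι] (hΓop : (γop • (1 : Matrix ι ι ℝ) - A * Aᵀ).PosSemidef) (Y : Finset ι)
    (hUd : ∀ φ : EuclideanSpace ℝ ι, HasFDerivAt U (U' φ) φ) (hκ₀ : 0 ≤ κ₀) (hτ : 0 < τ) (hθ1 : θ < 1) (hκθ : 2 * κ₀ * (1 + τ) * γop ≤ θ)
    (hstab : ∀ φ : EuclideanSpace ℝ ι, -(κ₀ * ∑ x ∈ Y, φ x ^ 2) ≤ U φ) (hlam : 0 ≤ lam)
    (hUsec : ∀ s : ℝ, 0 ≤ s → s ≤ 1 → ∀ a b : EuclideanSpace ℝ ι,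
      U ((1 - s) • a + s • b) - lam / 2 * (s * (1 - s)) * ∑ i, (a i - b i) ^ 2 ≤ (1 - s) * U a + s * U b)
    (hρ : lam * γop < 1) (ψ : EuclideanSpace ℝ ι) (hgd : ∀ ξ : EuclideanSpace ℝ κ, HasFDerivAt g (g' ξ) ξ) (hg'c : Continuous g')
    (hg'b : ∀ ξ : EuclideanSpace ℝ κ, ‖g' ξ‖ ≤ L)
    (k1 : Integrable (fun ξ : EuclideanSpace ℝ κ => exp (-U (matrixCLM A ξ + ψ)) * g ξ) (multivariateGaussian 0 (1 : Matrix κ κ ℝ)))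
    (k2 : Integrable (fun ξ : EuclideanSpace ℝ κ => exp (-U (matrixCLM A ξ + ψ)) * g ξ ^ 2) (multivariateGaussian 0 (1 : Matrix κ κ ℝ)))
    (k4 : Integrable (fun ξ : EuclideanSpace ℝ κ => exp (-U (matrixCLM A ξ + ψ)) * g ξ ^ 4) (multivariateGaussian 0 (1 : Matrix κ κ ℝ)))
    (k6 : Integrable (fun ξ : EuclideanSpace ℝ κ => exp (-U (matrixCLM A ξ + ψ)) * g ξ ^ 6) (multivariateGaussian 0 (1 : Matrix κ κ ℝ))) :
    (∫ ξ : EuclideanSpace ℝ κ, exp (-U (matrixCLM A ξ + ψ)) ∂(multivariateGaussian 0 (1 : Matrix κ κ ℝ)))⁻¹ *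
        (∫ ξ : EuclideanSpace ℝ κ, exp (-U (matrixCLM A ξ + ψ)) * (g ξ - ((∫ ξ : EuclideanSpace ℝ κ, exp (-U (matrixCLM A ξ + ψ))
            ∂(multivariateGaussian 0 (1 : Matrix κ κ ℝ)))⁻¹ * (∫ ξ : EuclideanSpace ℝ κ, exp (-U (matrixCLM A ξ + ψ)) * g ξ ∂(multivariateGaussian 0
            (1 : Matrix κ κ ℝ))))) ^ 6 ∂(multivariateGaussian 0 (1 : Matrix κ κ ℝ))) ≤
      50 * L ^ 6 / (1 - lam * γop) ^ 3 := by
  have hUc : Continuous U := continuous_iff_continuousAt.2 fun φ => (hUd φ).continuousAt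
  have hγ := op_letter_nonneg hΓop
  have hI := whitened_exp_integrable hΓop Y hUc.measurable hκ₀ hτ hθ1 hκθ hstab ψ
  have hZ : 0 < (∫ ξ : EuclideanSpace ℝ κ, exp (-U (matrixCLM A ξ + ψ)) ∂(multivariateGaussian 0 (1 : Matrix κ κ ℝ))) := integral_exp_pos hI
  have hρ0 : 0 < 1 - lam * γop := sub_pos.2 hρ
  -- the two lower moments ((503) and §1)
  have h2raw := obs_centred_variance_le hΓop Y hUd hκ₀ hτ hθ1 hκθ hstab hlam hUsec hρ ψ hgd hg'c hg'b k1 k2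
  have h4raw := obs_fourth_moment_le hΓop Y hUd hκ₀ hτ hθ1 hκθ hstab hlam hUsec hρ ψ hgd hg'c hg'b k1 k2 k4
  set μ : ℝ := ((∫ ξ : EuclideanSpace ℝ κ, exp (-U (matrixCLM A ξ + ψ)) ∂(multivariateGaussian 0 (1 : Matrix κ κ ℝ)))⁻¹ * (∫ ξ : EuclideanSpace ℝ κ,
      exp (-U (matrixCLM A ξ + ψ)) * g ξ ∂(multivariateGaussian 0 (1 : Matrix κ κ ℝ))))
  have hgc : Continuous g := continuous_iff_continuousAt.2 fun ξ => (hgd ξ).continuousAt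
  have hhc : Continuous fun ξ : EuclideanSpace ℝ κ => g ξ - μ := hgc.sub continuous_const
  have hEc : Continuous fun ξ : EuclideanSpace ℝ κ => exp (-U (matrixCLM A ξ + ψ)) :=
    continuous_exp.comp ((hUc.comp ((matrixCLM A).continuous.add continuous_const)).neg)
  -- `e·|g|³`, `e·g³`, `e·|g|⁵`-free: the odd powers we need are `3` only
  have k3 : Integrable (fun ξ : EuclideanSpace ℝ κ => exp (-U (matrixCLM A ξ + ψ)) * |g ξ| ^ 3) (multivariateGaussian 0 (1 : Matrix κ κ ℝ)) := by
    have hm : Continuous fun ξ : EuclideanSpace ℝ κ => exp (-U (matrixCLM A ξ + ψ)) * |g ξ| ^ 3 := hEc.mul ((continuous_abs.comp hgc).pow 3)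
    refine (k2.add k4).mono' hm.aestronglyMeasurable (ae_of_all _ fun ξ => ?_)
    rw [Real.norm_eq_abs, abs_of_nonneg (mul_nonneg (exp_pos _).le (pow_nonneg (abs_nonneg _) 3)), Pi.add_apply]
    have e2' : g ξ ^ 2 = |g ξ| ^ 2 := (sq_abs _).symm
    have e4' : g ξ ^ 4 = |g ξ| ^ 4 := (Even.pow_abs ⟨2, rfl⟩ (g ξ)).symm
    rw [e2', e4']
    set t := |g ξ|
    have ht : 0 ≤ t := abs_nonneg _
    have e0 := exp_pos (-U (matrixCLM A ξ + ψ))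
    have h3 : t ^ 3 ≤ t ^ 2 + t ^ 4 := by nlinarith [sq_nonneg (t ^ 2 - t), sq_nonneg (t - 1), ht, pow_nonneg ht 2]
    calc exp (-U (matrixCLM A ξ + ψ)) * t ^ 3 ≤ exp (-U (matrixCLM A ξ + ψ)) * (t ^ 2 + t ^ 4) := mul_le_mul_of_nonneg_left h3 e0.le
      _ = exp (-U (matrixCLM A ξ + ψ)) * t ^ 2 + exp (-U (matrixCLM A ξ + ψ)) * t ^ 4 := by ring
  have k3' : Integrable (fun ξ : EuclideanSpace ℝ κ => exp (-U (matrixCLM A ξ + ψ)) * g ξ ^ 3) (multivariateGaussian 0 (1 : Matrix κ κ ℝ)) :=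
    k3.mono' ((hEc.mul (hgc.pow 3)).aestronglyMeasurable) (ae_of_all _ fun ξ => by
      rw [Real.norm_eq_abs, abs_mul, abs_of_pos (exp_pos _), abs_pow])
  -- the centred powers `e·(g−μ)^k`, `k = 2, 3, 4, 6`
  have e2 : ∀ ξ : EuclideanSpace ℝ κ, exp (-U (matrixCLM A ξ + ψ)) * (g ξ - μ) ^ 2 =
      exp (-U (matrixCLM A ξ + ψ)) * g ξ ^ 2 - 2 * μ * (exp (-U (matrixCLM A ξ + ψ)) * g ξ) + μ ^ 2 * exp (-U (matrixCLM A ξ + ψ)) := fun ξ => by ring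
  have i2 : Integrable (fun ξ : EuclideanSpace ℝ κ => exp (-U (matrixCLM A ξ + ψ)) * (g ξ - μ) ^ 2) (multivariateGaussian 0 (1 : Matrix κ κ ℝ)) := by
    simp_rw [e2]; exact (k2.sub (k1.const_mul _)).add (hI.const_mul _)
  have e3 : ∀ ξ : EuclideanSpace ℝ κ, exp (-U (matrixCLM A ξ + ψ)) * (g ξ - μ) ^ 3 =
      exp (-U (matrixCLM A ξ + ψ)) * g ξ ^ 3 - 3 * μ * (exp (-U (matrixCLM A ξ + ψ)) * g ξ ^ 2) + 3 * μ ^ 2 * (exp (-U (matrixCLM A ξ + ψ)) * g ξ) -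
          μ ^ 3 * exp (-U (matrixCLM A ξ + ψ)) := fun ξ => by ring
  have i3 : Integrable (fun ξ : EuclideanSpace ℝ κ => exp (-U (matrixCLM A ξ + ψ)) * (g ξ - μ) ^ 3) (multivariateGaussian 0 (1 : Matrix κ κ ℝ)) := by
    simp_rw [e3]; exact ((k3'.sub (k2.const_mul _)).add (k1.const_mul _)).sub (hI.const_mul _)
  have e4 : ∀ ξ : EuclideanSpace ℝ κ, exp (-U (matrixCLM A ξ + ψ)) * (g ξ - μ) ^ 4 =
      exp (-U (matrixCLM A ξ + ψ)) * g ξ ^ 4 - 4 * μ * (exp (-U (matrixCLM A ξ + ψ)) * g ξ ^ 3) + 6 * μ ^ 2 * (exp (-U (matrixCLM A ξ + ψ)) * g ξ ^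
          2) - 4 * μ ^ 3 * (exp (-U (matrixCLM A ξ + ψ)) * g ξ) + μ ^ 4 * exp (-U (matrixCLM A ξ + ψ)) :=
    fun ξ => by ring
  have i4 : Integrable (fun ξ : EuclideanSpace ℝ κ => exp (-U (matrixCLM A ξ + ψ)) * (g ξ - μ) ^ 4) (multivariateGaussian 0 (1 : Matrix κ κ ℝ)) := by
    simp_rw [e4]; exact ((((k4.sub (k3'.const_mul _)).add (k2.const_mul _)).sub (k1.const_mul _)).add (hI.const_mul _))
  have i6 : Integrable (fun ξ : EuclideanSpace ℝ κ => exp (-U (matrixCLM A ξ + ψ)) * (g ξ - μ) ^ 6) (multivariateGaussian 0 (1 : Matrix κ κ ℝ)) := by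
    refine ((k6.const_mul 32).add (hI.const_mul (32 * μ ^ 6))).mono' ((hEc.mul (hhc.pow 6)).aestronglyMeasurable) (ae_of_all _ fun ξ => ?_)
    rw [Real.norm_eq_abs, abs_of_nonneg (mul_nonneg (exp_pos _).le (by positivity : (0 : ℝ) ≤ (g ξ - μ) ^ 6)), Pi.add_apply]
    have h := mul_le_mul_of_nonneg_left (sixth_pow_sub_le (g ξ) μ) (exp_pos (-U (matrixCLM A ξ + ψ))).le
    linarith
  have i6' : Integrable (fun ξ : EuclideanSpace ℝ κ => exp (-U (matrixCLM A ξ + ψ)) * ((g ξ - μ) ^ 3) ^ 2) (multivariateGaussian 0 (1 : Matrix κ κ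
      ℝ)) :=
    i6.congr (ae_of_all _ fun ξ => by
      dsimp only
      ring)
  -- the observable `(g − μ)³`: derivative `3(g−μ)²•Dg`, and `e‖D‖² ≤ 9L²·e(g−μ)⁴`
  have hF : ∀ ξ : EuclideanSpace ℝ κ, HasFDerivAt (fun ξ : EuclideanSpace ℝ κ => (g ξ - μ) ^ 3) ((3 * (g ξ - μ) ^ 2) • g' ξ) ξ := fun ξ => by
    have h := ((hgd ξ).sub_const μ).pow 3
    refine h.congr_fderiv ?_
    simp only [Nat.cast_ofNat, Nat.add_one_sub_one, nsmul_eq_mul]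
  have hF'c : Continuous fun ξ : EuclideanSpace ℝ κ => (3 * (g ξ - μ) ^ 2) • g' ξ := (continuous_const.mul (hhc.pow 2)).smul hg'c
  have pw : ∀ ξ : EuclideanSpace ℝ κ, exp (-U (matrixCLM A ξ + ψ)) * ‖(3 * (g ξ - μ) ^ 2) • g' ξ‖ ^ 2 ≤ 9 * L ^ 2 * (exp (-U (matrixCLM A ξ + ψ)) *
      (g ξ - μ) ^ 4) := fun ξ => by
    rw [norm_smul, mul_pow, Real.norm_eq_abs, abs_of_nonneg (by positivity : (0 : ℝ) ≤ 3 * (g ξ - μ) ^ 2)]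
    have h1 : ‖g' ξ‖ ^ 2 ≤ L ^ 2 := pow_le_pow_left₀ (norm_nonneg _) (hg'b ξ) 2
    have e0 := exp_pos (-U (matrixCLM A ξ + ψ))
    have hq : 0 ≤ exp (-U (matrixCLM A ξ + ψ)) * (3 * (g ξ - μ) ^ 2) ^ 2 := by positivity
    calc exp (-U (matrixCLM A ξ + ψ)) * ((3 * (g ξ - μ) ^ 2) ^ 2 * ‖g' ξ‖ ^ 2) = exp (-U (matrixCLM A ξ + ψ)) * (3 * (g ξ - μ) ^ 2) ^ 2 * ‖g' ξ‖ ^ 2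
        := by ring
      _ ≤ exp (-U (matrixCLM A ξ + ψ)) * (3 * (g ξ - μ) ^ 2) ^ 2 * L ^ 2 := mul_le_mul_of_nonneg_left h1 hq
      _ = 9 * L ^ 2 * (exp (-U (matrixCLM A ξ + ψ)) * (g ξ - μ) ^ 4) := by ring
  have iD : Integrable (fun ξ : EuclideanSpace ℝ κ => exp (-U (matrixCLM A ξ + ψ)) * ‖(3 * (g ξ - μ) ^ 2) • g' ξ‖ ^ 2) (multivariateGaussian 0 (1 :
      Matrix κ κ ℝ)) :=
    (i4.const_mul (9 * L ^ 2)).mono' ((hEc.mul ((continuous_norm.comp hF'c).pow 2)).aestronglyMeasurable) (ae_of_all _ fun ξ => by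
      rw [Real.norm_eq_abs, abs_of_nonneg (mul_nonneg (exp_pos _).le (sq_nonneg _))]
      exact pw ξ)
  -- Poincaré for `(g − μ)³` in the `ξ`-coordinates ((422) with `M = I`)
  have hP := tilted_poincare (M := (1 : Matrix κ κ ℝ)) (m := 1) (lam := lam * γop) (U := fun η : EuclideanSpace ℝ κ => U (matrixCLM A η + ψ))
    (U' := fun η : EuclideanSpace ℝ κ => (U' (matrixCLM A η + ψ)).comp (matrixCLM A)) Matrix.PosDef.one one_floor (whitened_hasFDerivAt hUd A ψ)
    (by positivity) (fun s hs0 hs1 a b => whitened_secant hΓop hlam hUsec ψ s hs0 hs1 a b) hρ (0 : EuclideanSpace ℝ κ)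
    (by simpa only [add_zero, inv_one] using hI) hF hF'c (by simpa only [add_zero, inv_one] using i3) (by simpa only [add_zero, inv_one] using i6')
    (by simpa only [add_zero, inv_one] using iD)
  simp only [add_zero, inv_one] at hP
  -- the right side of Poincaré
  have hR : (∫ ξ : EuclideanSpace ℝ κ, exp (-U (matrixCLM A ξ + ψ)) ∂(multivariateGaussian 0 (1 : Matrix κ κ ℝ)))⁻¹ * (∫ ξ : EuclideanSpace ℝ κ, exp
      (-U (matrixCLM A ξ + ψ)) * ‖(3 * (g ξ - μ) ^ 2) • g' ξ‖ ^ 2 ∂(multivariateGaussian 0 (1 : Matrix κ κ ℝ))) ≤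
      9 * L ^ 2 * ((∫ ξ : EuclideanSpace ℝ κ, exp (-U (matrixCLM A ξ + ψ)) ∂(multivariateGaussian 0 (1 : Matrix κ κ ℝ)))⁻¹ * (∫ ξ : EuclideanSpace ℝ
          κ, exp (-U (matrixCLM A ξ + ψ)) * (g ξ - μ) ^ 4 ∂(multivariateGaussian 0 (1 : Matrix κ κ ℝ)))) := by
    have h1 : (∫ ξ : EuclideanSpace ℝ κ, exp (-U (matrixCLM A ξ + ψ)) * ‖(3 * (g ξ - μ) ^ 2) • g' ξ‖ ^ 2 ∂(multivariateGaussian 0 (1 : Matrix κ κ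
        ℝ))) ≤
        ∫ ξ : EuclideanSpace ℝ κ, 9 * L ^ 2 * (exp (-U (matrixCLM A ξ + ψ)) * (g ξ - μ) ^ 4) ∂(multivariateGaussian 0 (1 : Matrix κ κ ℝ)) :=
            integral_mono iD (i4.const_mul _) pw
    rw [integral_const_mul] at h1
    have := mul_le_mul_of_nonneg_left h1 (inv_nonneg.2 hZ.le)
    linarith [this]
  -- rewrite the sixth power as the square of the cube and name the moments
  have epow : ∀ ξ : EuclideanSpace ℝ κ, exp (-U (matrixCLM A ξ + ψ)) * (g ξ - μ) ^ 6 = exp (-U (matrixCLM A ξ + ψ)) * ((g ξ - μ) ^ 3) ^ 2 := fun ξ =>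
      by ring
  simp_rw [epow]
  set E2 : ℝ := (∫ ξ : EuclideanSpace ℝ κ, exp (-U (matrixCLM A ξ + ψ)) ∂(multivariateGaussian 0 (1 : Matrix κ κ ℝ)))⁻¹ * (∫ ξ : EuclideanSpace ℝ κ,
      exp (-U (matrixCLM A ξ + ψ)) * (g ξ - μ) ^ 2 ∂(multivariateGaussian 0 (1 : Matrix κ κ ℝ))) with hE2
  set E3 : ℝ := (∫ ξ : EuclideanSpace ℝ κ, exp (-U (matrixCLM A ξ + ψ)) ∂(multivariateGaussian 0 (1 : Matrix κ κ ℝ)))⁻¹ * (∫ ξ : EuclideanSpace ℝ κ,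
      exp (-U (matrixCLM A ξ + ψ)) * (g ξ - μ) ^ 3 ∂(multivariateGaussian 0 (1 : Matrix κ κ ℝ))) with hE3
  set E4 : ℝ := (∫ ξ : EuclideanSpace ℝ κ, exp (-U (matrixCLM A ξ + ψ)) ∂(multivariateGaussian 0 (1 : Matrix κ κ ℝ)))⁻¹ * (∫ ξ : EuclideanSpace ℝ κ,
      exp (-U (matrixCLM A ξ + ψ)) * (g ξ - μ) ^ 4 ∂(multivariateGaussian 0 (1 : Matrix κ κ ℝ))) with hE4
  set E6 : ℝ := (∫ ξ : EuclideanSpace ℝ κ, exp (-U (matrixCLM A ξ + ψ)) ∂(multivariateGaussian 0 (1 : Matrix κ κ ℝ)))⁻¹ * (∫ ξ : EuclideanSpace ℝ κ,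
      exp (-U (matrixCLM A ξ + ψ)) * ((g ξ - μ) ^ 3) ^ 2 ∂(multivariateGaussian 0 (1 : Matrix κ κ ℝ)))
  have hE4nn : 0 ≤ E4 := mul_nonneg (inv_nonneg.2 hZ.le) (integral_nonneg fun ξ => mul_nonneg (exp_pos _).le (Even.pow_nonneg ⟨2, rfl⟩ _))
  have hb2 : E2 ≤ L ^ 2 / (1 - lam * γop) := h2raw
  have hb4 : E4 ≤ 5 * L ^ 4 / (1 - lam * γop) ^ 2 := h4raw
  -- the discriminant Cauchy–Schwarz `E3² ≤ E2·E4`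
  have hq : ∀ s : ℝ, 0 ≤ E2 * (s * s) + 2 * E3 * s + E4 := fun s => by
    have hnn : 0 ≤ (∫ ξ : EuclideanSpace ℝ κ, exp (-U (matrixCLM A ξ + ψ)) ∂(multivariateGaussian 0 (1 : Matrix κ κ ℝ)))⁻¹ * (∫ ξ : EuclideanSpace ℝ
        κ, exp (-U (matrixCLM A ξ + ψ)) * (s * (g ξ - μ) + (g ξ - μ) ^ 2) ^ 2 ∂(multivariateGaussian 0 (1 : Matrix κ κ ℝ))) :=
      mul_nonneg (inv_nonneg.2 hZ.le) (integral_nonneg fun ξ => mul_nonneg (exp_pos _).le (sq_nonneg _))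
    have e1 : ∀ ξ : EuclideanSpace ℝ κ, exp (-U (matrixCLM A ξ + ψ)) * (s * (g ξ - μ) + (g ξ - μ) ^ 2) ^ 2 =
        s * s * (exp (-U (matrixCLM A ξ + ψ)) * (g ξ - μ) ^ 2) + 2 * s * (exp (-U (matrixCLM A ξ + ψ)) * (g ξ - μ) ^ 3) + exp (-U (matrixCLM A ξ +
            ψ)) * (g ξ - μ) ^ 4 := fun ξ => by ring
    simp_rw [e1] at hnn
    have iA : Integrable (fun ξ : EuclideanSpace ℝ κ => s * s * (exp (-U (matrixCLM A ξ + ψ)) * (g ξ - μ) ^ 2) + 2 * s * (exp (-U (matrixCLM A ξ +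
        ψ)) * (g ξ - μ) ^ 3)) (multivariateGaussian 0 (1 : Matrix κ κ ℝ)) :=
      (i2.const_mul _).add (i3.const_mul _)
    rw [integral_add iA i4, integral_add (i2.const_mul _) (i3.const_mul _), integral_const_mul, integral_const_mul] at hnn
    calc (0 : ℝ) ≤ _ := hnn
      _ = E2 * (s * s) + 2 * E3 * s + E4 := by rw [hE2, hE3, hE4]; ring
  have hdisc := discrim_le_zero hq
  rw [discrim] at hdisc
  have hsq : (2 * E3) ^ 2 = 4 * E3 ^ 2 := by ring
  have hE3sq : E3 ^ 2 ≤ E2 * E4 := by linarith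
  -- assemble
  set d : ℝ := 1 - lam * γop
  have step1 : E6 ≤ E3 ^ 2 + d⁻¹ * (9 * L ^ 2 * E4) := by linarith [hP, mul_le_mul_of_nonneg_left hR (inv_nonneg.2 hρ0.le)]
  have step2 : E3 ^ 2 ≤ L ^ 2 / d * E4 := hE3sq.trans (mul_le_mul_of_nonneg_right hb2 hE4nn)
  have step3 : d⁻¹ * (9 * L ^ 2 * E4) = 9 * (L ^ 2 / d) * E4 := by ring
  have step4 : E6 ≤ 10 * (L ^ 2 / d) * E4 := by linarith
  calc E6 ≤ 10 * (L ^ 2 / d) * E4 := step4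
    _ ≤ 10 * (L ^ 2 / d) * (5 * L ^ 4 / d ^ 2) := mul_le_mul_of_nonneg_left hb4 (by positivity)
    _ = 50 * L ^ 6 / d ^ 3 := by ring

/-! ## §3. Toy -/

/-- Toy (the constants: `(1 + 9)·5 = 50`). -/
example (L d : ℝ) : 10 * (L ^ 2 / d) * (5 * L ^ 4 / d ^ 2) = 50 * L ^ 6 / d ^ 3 := by ring

end Summit.QuantumFields.BalabanUV.T4Continuum.NE7b.SupWhitenedObservableSixthMoment

end
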